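import Summits.HubbardSuperconductivity.HubbardSuperconductivity.Theorems.BalabanIRBirComplexStableXYRMultiSlice
import HarnessLib

/-!
# BalabanIR crux 2R `BirComplexStableXYR` (stmt-HubbardSuperconductivity-14845): the `r = 2` case of stub S5a is a theorem

Support file for line `fat-gaussian-defect-calculus` (lead c6).  Stub S5a `stub_complexPositivityI3` of the reshaped skeleton
(`0 < Re Z` for (U1)(N)(A)(C)(R)(P)(I3) tables, `K ≥ K₀(r,B,c₀)`, even `L₀ ≤ L ≤ M`, every `r ≥ 2`) follows from its
restriction to `r ≥ 3` (`stub_complexPositivityR3I3`): at `r = 2` the slice transfer kernel is Hermitian by (R) and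
`0 < Re Z` at even `M` is the landed `birEven_partitionFunction_pos` (every `K`, `L`; thresholds `K₀ = 0`, `L₀ = 0`), via the
table ⇒ functional bridge `timeReflection_functional_of_table` — exactly as in `birMulti_complexPositivity_reduction`, now with
the extra (idle at `r = 2`) hypothesis (I3).  So the registered positivity stub of the line is precisely its open content
`r ≥ 3`. [folklore]
-/

set_option linter.dupNamespace false -- summit = problem name (single-conjunct summit), D-0017

noncomputable section

namespace Summit.HubbardSuperconductivity.HubbardSuperconductivity.Theorems

open scoped BigOperators ComplexConjugate
open MeasureTheory Literature.Probability.LatticeModels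
open Summit.HubbardSuperconductivity.BirComplexStableXYNegative

/-- **Registered sub-goal `complexPositivityI3_of_ge3`**: positivity on the (I3) class for `r ≥ 3` implies it for every
`r ≥ 2` (the case `r = 2` is `birEven_partitionFunction_pos`, thresholds `0, 0`). [folklore] -/
theorem complexPositivityI3_of_ge3 : (∀ (r : ℕ) (B c₀ : ℝ), 3 ≤ r → 0 < c₀ → ∃ K₀ : ℝ, ∃ L₀ : ℕ, ∀ K : ℝ, K₀ ≤ K → ∀ c : Table r, (∀ n ∈ c.support, ∑ w, n w = 0) → c.sum (fun _ a => a) = 0 → normA c ≤ B → (∀ φ : W r → ℝ, c₀ * ∑ w, ∑ w', (1 - Real.cos (φ w - φ w')) ≤ (genF c φ).re) → (∀ n : Freq r, c (fun w => n (w.1, w.2.1, Fin.rev w.2.2)) = (starRingEnd ℂ) (c (-n))) → (∀ n : Freq r, c (fun w => n (Fin.rev w.1, Fin.rev w.2.1, w.2.2)) = c n) → (∀ v : W r → ℝ, c.sum (fun n a => a.im * (∑ w, (n w : ℝ) * v w) ^ 2) = 0) → ∀ (L M : ℕ) [NeZero L] [NeZero M], L₀ ≤ L → L ≤ M → Even L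 → Even M → 0 < (partZ K c L M).re) → ∀ (r : ℕ) (B c₀ : ℝ), 2 ≤ r → 0 < c₀ → ∃ K₀ : ℝ, ∃ L₀ : ℕ, ∀ K : ℝ, K₀ ≤ K → ∀ c : Table r, (∀ n ∈ c.support, ∑ w, n w = 0) → c.sum (fun _ a => a) = 0 → normA c ≤ B → (∀ φ : W r → ℝ, c₀ * ∑ w, ∑ w', (1 - Real.cos (φ w - φ w')) ≤ (genF c φ).re) → (∀ n : Freq r, c (fun w => n (w.1, w.2.1, Fin.rev w.2.2)) = (starRingEnd ℂ) (c (-n))) → (∀ n : Freq r, c (fun w => n (Fin.rev w.1, Fin.rev w.2.1, w.2.2)) = c n) → (∀ v : W r → ℝ, c.sum (fun n a => a.im * (∑ w, (n w : ℝ) * v w) ^ 2) = 0) → ∀ (L M : ℕ) [NeZero L] [NeZero M], L₀ ≤ L → L ≤ M → Even L → Even M → 0 < (partZ K c L M).re := by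
  intro h3 r B c₀ hr hc₀
  rcases (show r = 2 ∨ 3 ≤ r by omega) with rfl | h3r
  · refine ⟨0, 0, ?_⟩
    intro K _ c _ _ _ _ hR _ _ L M _ _ _ _ _ hM
    have h := birEven_partitionFunction_pos c K L M (timeReflection_functional_of_table 2 c hR) hM
    dsimp only at h
    dsimp only [partZ, action, genF, sh, cube]
    exact h.1
  · obtain ⟨K₀, L₀, H⟩ := h3 r B c₀ h3r hc₀
    exact ⟨K₀, L₀, H⟩

end Summit.HubbardSuperconductivity.HubbardSuperconductivity.Theorems

end
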